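import Mathlib
import Summits.PneNP.PneNP.Theorems.Nc03AvoidResidualCoreCandCutNormCertificate

/-!
# Sign averaging over completions of a prefix — line «sfm-bl» (MACHINE-PLAN M3/M4, PROOF-SFM-BL §3 COMPUTABILITY)

FRONTIER F-N1c; nothing here bears on P vs NP.

The identity behind the exact evaluation of the potential on a prefix assignment: for multiplicities
`μ : Fin m → ℕ`, a set `P` of fixed outputs and their values `T₀`,
`Σ_{T ⊇ T₀|P} Π_j χ(T_j)^{μ_j} = (Π_{j∈P} χ(T₀ j)^{μ_j}) · Π_{j∉P} (2·[μ_j even])`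
(`sum_filter_prod_boolSign_pow`); in particular over ALL signings the sum is `2^m·[all μ_j even]`-shaped
(`sum_prod_boolSign_pow`).  `χ = CandCutNorm.boolSign` cast to `ℝ`.
-/

namespace Summit.PneNP.PneNP.Theorems.SfmBl

open Finset BigOperators

/-- `Σ_{b : Bool} χ(b)^μ = 2·[μ even]`. -/
theorem sum_boolSign_pow (μ : ℕ) :
    ∑ b : Bool, (((CandCutNorm.boolSign b : ℤ) : ℝ)) ^ μ = if Even μ then (2 : ℝ) else 0 := by
  rw [Fintype.sum_bool]
  simp only [CandCutNorm.boolSign]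
  push_cast
  simp only [one_pow]
  rcases Nat.even_or_odd μ with h | h
  · rw [if_pos h, h.neg_one_pow]; norm_num
  · rw [if_neg (Nat.not_even_iff_odd.2 h), h.neg_one_pow]; norm_num

/-- SIGN AVERAGING OVER THE COMPLETIONS OF A PREFIX: with the outputs in `P` fixed to `T₀`,
`Σ_{T : ∀ j ∈ P, T j = T₀ j} Π_j χ(T j)^{μ j} = (Π_{j ∈ P} χ(T₀ j)^{μ j}) · Π_{j ∈ Pᶜ} (2·[μ j even])`. -/
theorem sum_filter_prod_boolSign_pow (m : ℕ) (μ : Fin m → ℕ) (P : Finset (Fin m))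
    (T₀ : Fin m → Bool) :
    ∑ T ∈ (Finset.univ : Finset (Fin m → Bool)).filter (fun T => ∀ j ∈ P, T j = T₀ j),
        ∏ j, (((CandCutNorm.boolSign (T j) : ℤ) : ℝ)) ^ (μ j)
      = (∏ j ∈ P, (((CandCutNorm.boolSign (T₀ j) : ℤ) : ℝ)) ^ (μ j))
          * ∏ j ∈ Pᶜ, (if Even (μ j) then (2 : ℝ) else 0) := by
  classical
  set t : Fin m → Finset Bool := fun j => if j ∈ P then {T₀ j} else Finset.univ with ht
  have hset : (Finset.univ : Finset (Fin m → Bool)).filter (fun T => ∀ j ∈ P, T j = T₀ j)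
      = Fintype.piFinset t := by
    ext T
    simp only [Finset.mem_filter, Finset.mem_univ, true_and, Fintype.mem_piFinset, ht]
    constructor
    · intro h j
      by_cases hj : j ∈ P
      · simp [hj, h j hj]
      · simp [hj]
    · intro h j hj
      have := h j
      simpa [hj] using this
  rw [hset, ← Finset.prod_univ_sum t (fun j b => (((CandCutNorm.boolSign b : ℤ) : ℝ)) ^ (μ j)),
    ← Finset.prod_mul_prod_compl P]
  congr 1
  · refine Finset.prod_congr rfl fun j hj => ?_
    simp [ht, hj]
  · refine Finset.prod_congr rfl fun j hj => ?_
    rw [Finset.mem_compl] at hj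
    simp only [ht, hj, if_false]
    exact sum_boolSign_pow (μ j)

/-- Over ALL signings: `Σ_T Π_j χ(T j)^{μ j} = Π_j (2·[μ j even])` (`= 2^m` iff every `μ j` is even, else `0`). -/
theorem sum_prod_boolSign_pow (m : ℕ) (μ : Fin m → ℕ) :
    ∑ T : Fin m → Bool, ∏ j, (((CandCutNorm.boolSign (T j) : ℤ) : ℝ)) ^ (μ j)
      = ∏ j, (if Even (μ j) then (2 : ℝ) else 0) := by
  classical
  have h := sum_filter_prod_boolSign_pow m μ ∅ (fun _ => false)
  rw [Finset.filter_true_of_mem (fun T _ => by simp), Finset.prod_empty, one_mul,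
    Finset.compl_empty] at h
  exact h

/-- The all-even case: `Σ_T Π_j χ(T j)^{μ j} = 2^m`. -/
theorem sum_prod_boolSign_pow_of_even (m : ℕ) (μ : Fin m → ℕ) (h : ∀ j, Even (μ j)) :
    ∑ T : Fin m → Bool, ∏ j, (((CandCutNorm.boolSign (T j) : ℤ) : ℝ)) ^ (μ j) = 2 ^ m := by
  rw [sum_prod_boolSign_pow]
  simp [h]

/-- Some odd multiplicity: `Σ_T Π_j χ(T j)^{μ j} = 0`. -/
theorem sum_prod_boolSign_pow_of_odd (m : ℕ) (μ : Fin m → ℕ) {j₀ : Fin m} (h : ¬ Even (μ j₀)) :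
    ∑ T : Fin m → Bool, ∏ j, (((CandCutNorm.boolSign (T j) : ℤ) : ℝ)) ^ (μ j) = 0 := by
  rw [sum_prod_boolSign_pow]
  exact Finset.prod_eq_zero (Finset.mem_univ j₀) (by simp [h])

end Summit.PneNP.PneNP.Theorems.SfmBl
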